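/-
Origin: expansion seat `planner-pub-hodgecm-mc-axioms-1-g14-0`, handover #W34 2026-08-20T15:53:55Z md5 a54d875649d2 (PKG c16e8d74f969 → a54d875649d2; 388 l.; MECHANICAL (iib-R) rewrite v3.1 of the PKG file as it stands (11 token edits; rules R1x1+RX[h₂]x10)) (`HOME/mc/pub-hodgecm-mc-axioms-1-g14/revendor/kit-r55/stage55/HodgeCM/Model/ThetaClassInputInstance.lean`, md5 a54d875649d2, 388 lines);
landed by the gen-22 packager (p-g22) in gate run 55 REPLACES the earlier landed copy of `HodgeCM/Model/ThetaClassInputInstance.lean` (seat copy carried the packager Origin header of an earlier run (stripped)).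
-/
/-
g9 DOC-ONLY RE-STAGE by `planner-pub-hodgecm-mc-theta-3-g9-0` 2026-08-19 of the theta-3-g8 (W1) draft 159941f6a585: the docstring of the field
`ThetaSpaceInput.KΓ` now names the pin's actual index `satLevelRegimeOf V h Γ.K` (the g8 text `(Γ.K).map (finToGU h)` was superseded,
g8 HANDOFF §7a / BINDER-TRIAGE §61); Lean content byte-identical to 159941f6a585.
-/
/-
(Θ-sat)/(W1) RE-STAGE DRAFT by `planner-pub-hodgecm-mc-theta-3-g8-0` 2026-08-19 over the installed bytes f12a00eb84c6: + field
`ThetaSpaceInput.KΓ`, `Θ` switched to `thetaSpaceSatOf … (X.KΓ Γ)`, + `SupplySituationAt.sat`, `classSupplyDataAt` via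
`classSupplyDataSatAt` (leaf `Model/ThetaSpaceSat`); everything else byte-identical.  UNCHECKED (rides RUN 37 with the
`Level`-pair root packet).
Origin: expansion seat `planner-pub-hodgecm-mc-theta-3-g3-0`, handover #3 2026-08-19T00:35Z md5 0929594f0aee78ee10b88a38f6c52012 (NEW additive leaf, 352 l.; ns HodgeCM.Model; imports HodgeCM.Model.ThetaSpace (#2) + HodgeCM.Model.ThetaSideInstance ((v21) v2 cb2e6dd72a1f, period-2-g4 kit) + HodgeCM.Model.E2Instance (r32); WeilPairData.weightFunctions, structure ThetaSpaceInput U V c (+ .Θ, .toThetaClassInput), Model.thetaClassInputOf U X (= the I of R6, CLASSICAL insta (`HOME/mc/pub-hodgecm-mc-theta-3-g3/lean/stage/HodgeCM/Model/ThetaClassInputInstance.lean`, md5 0929594f, 352 lines);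
landed by the gen-9 packager (p-g9) in gate run 33 as `HodgeCM/Model/ThetaClassInputInstance.lean` (verbatim).
-/
/-
Copyright (c) 2026. Released under Apache 2.0 license as described in the file LICENSE.
Cell pub-hodgecm, MODEL layer (construction prover mc-theta-3, gen 3), nodes W7a-pin / J-W7a / T3-classPacks of
`MODEL-DAG.md`: the CLASSICAL instance of the theta-class input `I` and the `classPacks` producer over it.
-/
import Summits.HodgeConjecture.HodgeCM.Model.ThetaSpaceSat
import Summits.HodgeConjecture.HodgeCM.Model.ThetaSideInstance
import Summits.HodgeConjecture.HodgeCM.Model.E2Instance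

/-!
# The classical theta-class input and the `classPacks` producer

E's R6 pin is `Theta := Model.thetaOf U I` for a family `I V c : ThetaClassInput U V c`
(`Model/ThetaSideInstance`).  This file PRODUCES that family — **`Model.thetaClassInputOf U X`** — in the
CLASSICAL reading, from a smaller input record `X V c : ThetaSpaceInput U V c`, and reduces E's supply binder
`classPacks` over the resulting theta model to per-`(V, c, k, N)` SUPPLY SITUATIONS (`SupplySituationAt`):

* classical reading: `GU := G₁` (the archimedean group itself), `Kc Γ := K₁`, `κ Γ := κ₁`, `τ Γ := τ₁`,
  `ιinf := id`, `η₁ Γ := id`, `ΓU Γ := Δ Γ` (classically the level IS the lattice), `hΔ Γ` / `hη Γ` the trivial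
  corrections (`ThetaSpace.isLevelCorrected_id` / `isWeightMatched_id`, `c := 1`), `D Γ := X.D Γ` a classical
  class-map datum of `Γ \ 𝔹²` into the universe (the `D_Γ` of `Model.classMapDatumOf … Γ h 𝔣 (MonoidHom.id U21)
  (isLevelCorrected_id …) (isWeightMatched_id …)`, node D1-aut), and
  **`Θ k Γ := thetaSpaceSatOf (X.P k) (X.ιinf Γ) (X.Δ Γ) X.κ₁ X.τ₁ (X.KΓ Γ) (X.P k).weightFunctions`** — the span
  of the archimedean restrictions of the adelic theta forms of the pair `(G_U, U(W_k))` with weight functions of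
  type `k`, over the adelic `K`-type situations SATURATED at the compact open `X.KΓ Γ ≤ G_U(𝔸)` of the level
  (`ThetaSpace.KTypeSituation.IsSaturated`, leaf `Model/ThetaSpaceSat`; (Θ-sat)/(Θ-sat-K) of BINDER-TRIAGE §56/§57:
  the theta forms read by the see-saw junction are right-`K_f`-invariant; the unsaturated v2 space is the instance
  `KΓ := ⊥`, `thetaSpaceSatOf_bot`): the finite level of a theta form lives INSIDE the supremum, one situation
  `K_∞ × K_f(M)` per test function `φ_N`, `K_f(M) ≤ K_Γ` deep enough;
* hence (`thetaOf_thetaClassInputOf`, `rfl`) the END STATE's `Θ_k(Γ)` is the set of `(1,0)`-classes of `X_Γ`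
  whose pulled-back one-form is the restriction to `G₁` of an adelic theta form of type `k`, of any `K`-type;
* **`classPacksOf`**: E's binder `classPacks` (re-based on `ClassSupplyPackN`, `Model/SupplyClassLevel`) for ANY
  theta model `T` whose `Θ_k(Γ)` contains these theta classes — in particular (`classPacksOf_thetaModelOf`) for
  the END STATE's `thetaModelOf … (thetaOf _ (thetaClassInputOf _ X)) d12 d34`, where the containment is `rfl` —
  from ONE `SupplySituationAt (X V c) k N` per good sextic context, type index `k ∈ {0, 1}` and `N > 0`: a level
  `Γ₀`, a `K`-type situation `S` of level `X.Δ Γ₀` along `X.ιinf Γ₀`, the membership `fam` of `φ_N = P.testFunT N`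
  in a test family of `S`, and holomorphy `hol` of the restricted theta forms (the W6b-hol input).  The character
  bookkeeping `char_mem` is DISCHARGED here by the canonical choice `𝓕 k := (X.P k).weightFunctions`.

What this file EXCLUDES (ruling (J-lvl′), carver model1-g4 2026-08-19T00:25:32Z, and this lane's analysis (B)):
nothing is instantiated in the ADELIC reading of `ThetaClassInput` with a level-independent `K`-type — there the
forms of `φ_N = φ_∞ ⊗ 1_{x₀ + N𝒪̂³}` for growing `N` would have to be right-invariant under one fixed open compact
subgroup of `G_U(𝔸_f)`, which they are not (PerL tex l. 533 «for all sufficiently small `K_f`»); the level-indexed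
adelic reading of (v21) v2 is instantiable too but is not used: the classical theta space makes `Θ_k(Γ)` canonical
(no choice of `K`-type) and states exhaustion (C3) against all `K`-types at once.

Nothing is cited and nothing is minted: definitions and `rfl`/one-line kernel lemmas over `Model/ThetaSpace`,
`Model/ThetaSideInstance`, `Model/SupplyClassLevel`, `Model/E2Instance`.
-/

set_option autoImplicit false

noncomputable section

open MeasureTheory
open Literature.NumberTheory.Automorphic Literature.NumberTheory.Weil1964
open Literature.NumberTheory.Automorphic.WeightForms (ClassMapDatum thetaClasses restrictHom IsLevelCorrected
  IsWeightMatched)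
open Literature.AlgebraicGeometry.HodgeTheory
open Literature.NumberTheory.Automorphic.PicardCM
open HodgeCM.PerL34.Seesaw HodgeCM.PerL34.RationalCoset HodgeCM.PerL34.SupplyAdelic
open HodgeCM.Model.SupplyInstance HodgeCM.Model.SupplyResidual
open HodgeCM.Model.SupplyResidual.WeilPairData (charInv)
open HodgeCM.Model.ThetaSpace
open scoped Classical

namespace HodgeCM
namespace Model

/-! ### § 0. The canonical weight functions of a pair -/

namespace SupplyResidual.WeilPairData

variable {K L : Type} [Field K] [NumberField K] [Field L] [NumberField L] [Algebra K L] [FiniteDimensional K L]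
variable {J : Type} [Fintype J] {GU : Type} [Group GU] [TopologicalSpace GU]
variable (P : WeilPairData K L J GU)

/-- **The weight functions of the pair**: the functions `q ↦ χ(q⁻¹)` for the characters `χ` of `T(K)\T(𝔸)` whose
archimedean type is matched to the weight `P.w` (`χ(t) · w(t) = 1` on `T_∞`) — exactly the functions against
which `ResidualT` integrates the theta kernel. -/
def weightFunctions : Set C(relNormOneIdeles K L ⧸ relNormOneRat K L, ℂ) :=
  {f | ∃ χ : PontryaginDual (relNormOneIdeles K L ⧸ relNormOneRat K L),
    (∀ t : relNormOneInfUnits K L,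
      ((χ ((relNormOneInfToIdeles K L t : relNormOneIdeles K L) :
        relNormOneIdeles K L ⧸ relNormOneRat K L) : Circle) : ℂ) * P.w t = 1) ∧ f = charInv χ}

variable {P} in
/-- (Ported verbatim from the HodgeCMPerL package; no docstring in the source.) -/
theorem charInv_mem_weightFunctions {χ : PontryaginDual (relNormOneIdeles K L ⧸ relNormOneRat K L)}
    (hχ : ∀ t : relNormOneInfUnits K L,
      ((χ ((relNormOneInfToIdeles K L t : relNormOneIdeles K L) :
        relNormOneIdeles K L ⧸ relNormOneRat K L) : Circle) : ℂ) * P.w t = 1) :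
    charInv χ ∈ P.weightFunctions :=
  ⟨χ, hχ, rfl⟩

end SupplyResidual.WeilPairData

/-! ### § 1. The input record of the classical instance -/

/-- **Input of the classical theta-class instance in the context `(V, c)`.**  Level-independent: the archimedean
component group `G₁` with compact `K₁`, `κ₁`, the weight `τ₁` on `W`; the carriers and the PAIR DATA `P k` of the
four line pairs `(G_U, U(W_k))` (one adelic group `GU = G_U(𝔸)`, one Weil–theta package per type index).  Per
level: the arithmetic group `Δ Γ ≤ G₁`, the classical class-map datum `D Γ` of `Γ \ 𝔹²` into the universe, and the
archimedean inclusion `ιinf Γ : G₁ →* GU` (allowed to depend on the level through the frame identifying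
`U(V ⊗_{ι₁} ℂ)` with `G₁`). -/
structure ThetaSpaceInput (U : Universe) {Lc : CMField} {ι₁ : Lc →+* ℂ} (V : HermSpace3 Lc ι₁) (c : SeesawCtx Lc) :
    Type 1 where
  /-- the archimedean component group `G₁ = U(2,1)` -/
  G₁ : Type
  [instG₁ : Group G₁]
  /-- its compact subgroup `K₁ = Stab(x₀)` -/
  K₁ : Type
  [instK₁ : Group K₁]
  /-- `K₁ → G₁` -/
  κ₁ : K₁ →* G₁
  /-- the weight module (`Fin 2 → ℂ` for one-forms on the ball) -/
  W : Type
  [instW : AddCommGroup W]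
  [instWm : Module ℂ W]
  [instWr : Module.IsReflexive ℂ W]
  /-- the classical weight (the cotangent cocycle at `x₀`) -/
  τ₁ : Representation ℂ K₁ W
  /-- the arithmetic group of the level inside `G₁` -/
  Δ : Level V → Subgroup G₁
  /-- the classical class-map datum of `Γ \ 𝔹²` into the universe, per level -/
  D : ∀ Γ : Level V, ClassMapDatum (MonoidHom.id G₁) (isLevelCorrected_id (Δ Γ) κ₁ τ₁)
    (isWeightMatched_id κ₁ τ₁) (U.CohC (U.pms Lc ι₁ V Γ) 1)
  /-- the totally real base field `L₀` as a carrier -/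
  K : Type
  [instK : Field K]
  [instKnf : NumberField K]
  /-- the CM field as a carrier -/
  L : Type
  [instL : Field L]
  [instLnf : NumberField L]
  [instAlg : Algebra K L]
  [instFD : FiniteDimensional K L]
  /-- Lagrangian coordinate index of the line pairs -/
  J : Type
  [instJ : Fintype J]
  /-- the adelic group `G_U(𝔸)` -/
  GU : Type
  [instGU : Group GU]
  [instGUtop : TopologicalSpace GU]
  [instGUtg : IsTopologicalGroup GU]
  [instGUlc : LocallyCompactSpace GU]
  /-- the Weil–theta pair data of the line pair `(G_U, U(W_k))`, per type index `k` -/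
  P : Fin 4 → WeilPairData K L J GU
  /-- cocompactness of the rational points -/
  [instCompact : ∀ k : Fin 4, CompactSpace (GU ⧸ (P k).ΓU)]
  /-- the archimedean inclusion `G₁ → G_U(𝔸)` at the level `Γ` -/
  ιinf : Level V → (G₁ →* GU)
  /-- the saturation index of the level: the saturation subgroup of its compact open `K_f` in `G_U(𝔸)` ((Θ-sat-K): the
  pin sets `KΓ Γ := satLevelRegimeOf V h Γ.K`, mc-discharge-1 `Model/Junction/LevelSaturation`; degenerate and purely
  classical inputs take `⊥`) -/
  KΓ : Level V → Subgroup GU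

attribute [instance] ThetaSpaceInput.instG₁ ThetaSpaceInput.instK₁ ThetaSpaceInput.instW ThetaSpaceInput.instWm
  ThetaSpaceInput.instWr ThetaSpaceInput.instK ThetaSpaceInput.instKnf ThetaSpaceInput.instL ThetaSpaceInput.instLnf
  ThetaSpaceInput.instAlg ThetaSpaceInput.instFD ThetaSpaceInput.instJ ThetaSpaceInput.instGU
  ThetaSpaceInput.instGUtop ThetaSpaceInput.instGUtg ThetaSpaceInput.instGUlc ThetaSpaceInput.instCompact

namespace ThetaSpaceInput

variable {U : Universe} {Lc : CMField} {ι₁ : Lc →+* ℂ} {V : HermSpace3 Lc ι₁} {c : SeesawCtx Lc}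
variable (X : ThetaSpaceInput U V c)

/-- **The (saturated) classical theta space of type index `k` at level `Γ`** (binder `Θ k Γ` of the instance):
the ONE junction switch of (Θ-sat). -/
def Θ (k : Fin 4) (Γ : Level V) : Submodule ℂ (weightForms (X.Δ Γ) X.κ₁ X.τ₁) :=
  thetaSpaceSatOf (X.P k) (X.ιinf Γ) (X.Δ Γ) X.κ₁ X.τ₁ (X.KΓ Γ) (X.P k).weightFunctions

/-- (Ported verbatim from the HodgeCMPerL package; no docstring in the source.) -/
theorem Θ_eq (k : Fin 4) (Γ : Level V) :
    X.Θ k Γ = thetaSpaceSatOf (X.P k) (X.ιinf Γ) (X.Δ Γ) X.κ₁ X.τ₁ (X.KΓ Γ) (X.P k).weightFunctions := rfl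

/-- Saturated theta forms are theta forms (the v2 space). -/
theorem Θ_le_thetaSpaceOf (k : Fin 4) (Γ : Level V) :
    X.Θ k Γ ≤ thetaSpaceOf (X.P k) (X.ιinf Γ) (X.Δ Γ) X.κ₁ X.τ₁ (X.P k).weightFunctions :=
  thetaSpaceSatOf_le_thetaSpaceOf

/-- **The classical theta-class input** built from `X` (all level-indexed `K`-type fields constant). -/
def toThetaClassInput : ThetaClassInput U V c where
  GU := X.G₁
  W := X.W
  G₁ := X.G₁
  K₁ := X.K₁
  ιinf := MonoidHom.id X.G₁
  κ₁ := X.κ₁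
  τ₁ := X.τ₁
  Kc := fun _ => X.K₁
  κ := fun _ => X.κ₁
  τ := fun _ => X.τ₁
  η₁ := fun _ => MonoidHom.id X.K₁
  hη := fun _ => isWeightMatched_id X.κ₁ X.τ₁
  ΓU := X.Δ
  Δ := X.Δ
  hΔ := fun Γ => isLevelCorrected_id (X.Δ Γ) X.κ₁ X.τ₁
  D := X.D
  Θ := X.Θ

/-- (Ported verbatim from the HodgeCMPerL package; no docstring in the source.) -/
@[simp] theorem toThetaClassInput_D (Γ : Level V) : X.toThetaClassInput.D Γ = X.D Γ := rfl
/-- (Ported verbatim from the HodgeCMPerL package; no docstring in the source.) -/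
@[simp] theorem toThetaClassInput_Θ (k : Fin 4) (Γ : Level V) : X.toThetaClassInput.Θ k Γ = X.Θ k Γ := rfl
/-- (Ported verbatim from the HodgeCMPerL package; no docstring in the source.) -/
@[simp] theorem toThetaClassInput_ιinf : X.toThetaClassInput.ιinf = MonoidHom.id X.G₁ := rfl

end ThetaSpaceInput

/-! ### § 2. The instance of record and its unfolding -/

section Instance

variable (U : Universe)
  (X : ∀ {Lc : CMField} {ι₁ : Lc →+* ℂ} (V : HermSpace3 Lc ι₁) (c : SeesawCtx Lc), ThetaSpaceInput U V c)

/-- **`I` of record (classical instance)**: `I V c := (X V c).toThetaClassInput`. -/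
def thetaClassInputOf {Lc : CMField} {ι₁ : Lc →+* ℂ} (V : HermSpace3 Lc ι₁) (c : SeesawCtx Lc) :
    ThetaClassInput U V c :=
  (X V c).toThetaClassInput

variable {Lc : CMField} {ι₁ : Lc →+* ℂ} (V : HermSpace3 Lc ι₁) (c : SeesawCtx Lc) (k : Fin 4) (Γ : Level V)

/-- **The END STATE's `Θ_k(Γ)` unfolded** (definitional): the theta classes, through the classical class-map datum
`(X V c).D Γ`, of the classical theta space of type `k` at level `Γ`. -/
theorem thetaOf_thetaClassInputOf :
    thetaOf U (thetaClassInputOf U X) V c k Γ =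
      thetaClasses (MonoidHom.id (X V c).G₁) ((X V c).D Γ) ((X V c).Θ k Γ) :=
  rfl

/-- … hence `Θ_k(Γ) ⊆ F¹ H¹(X_Γ)` of the datum. -/
theorem thetaOf_thetaClassInputOf_subset_H10 :
    thetaOf U (thetaClassInputOf U X) V c k Γ ⊆ ((X V c).D Γ).H10 :=
  thetaOf_subset_H10 U (thetaClassInputOf U X) V c k Γ

end Instance

/-! ### § 3. Supply situations and the `classPacks` producer -/

section Supply

variable {U : Universe} {Lc : CMField} {ι₁ : Lc →+* ℂ} {V : HermSpace3 Lc ι₁} {c : SeesawCtx Lc}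

/-- **A supply situation at `φ_N`** for the input `X`, type index `k`: a level `Γ₀`, an adelic `K`-type situation
`S` over the pair `X.P k` of level `X.Δ Γ₀` along `X.ιinf Γ₀` (this is where `K_f(N) ⊆ Stab(φ_{N,f})` and the
depth of `Γ₀` live), the membership of `φ_N` in a test family of `S`, and the holomorphy of the restricted theta
forms of `S` against the weight functions of the pair (W6b-hol). -/
structure SupplySituationAt (X : ThetaSpaceInput U V c) (k : Fin 4) (N : ℕ) : Type 1 where
  /-- the level at which the classes are supplied -/
  Γ₀ : Level V
  /-- the `K`-type situation of `φ_N` -/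
  S : KTypeSituation (X.P k) (X.ιinf Γ₀) (X.Δ Γ₀) X.κ₁ X.τ₁
  /-- `φ_N` belongs to a test family of the situation -/
  fam : ∃ j ∈ S.𝓙, ∃ ℓ : Module.Dual ℂ X.W, j.1 (S.ι ℓ) = (X.P k).testFunT N
  /-- the restricted theta forms of the situation are holomorphic -/
  hol : ∀ j ∈ S.𝓙, ∀ f ∈ (X.P k).weightFunctions, restrictHom (X.ιinf Γ₀) S.hΔ S.hη
    ((X.P k).kernelDatum.thetaForm (probHaarRelNormOneQuot X.K X.L) (X.P k).kernelDatum_thetaLinear S.κ j.1 j.2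
      S.ι S.hι f) ∈ (X.D Γ₀).Hol
  /-- the situation is saturated at the compact open of `Γ₀` (every `k_f ∈ K_{Γ₀}` is an index element with
  trivial weight: (Θ-sat), supplied by `ArchKTypeData.sat` at a level `Γ₀ = (Γ(M), K(M))` deep enough) -/
  sat : S.IsSaturated (X.KΓ Γ₀)
  /-- the situation is strict: its test families are `K`-type vectors ON THE NOSE ((SS-K) exit (X1); supplied by
  `ProductKTypeData.situation_isStrict`) -/
  strict : S.IsStrict

variable {X : ThetaSpaceInput U V c} {k : Fin 4}

/-- Level-indexed class supply data at `φ_N` from a supply situation, for any theta model whose `Θ_k(Γ₀)` contains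
the classical theta classes (`char_mem` discharged by `𝓕 := weightFunctions`, `theta_sub` by `ThetaSpace`). -/
def SupplySituationAt.classSupplyDataAt {N : ℕ} (A : SupplySituationAt X k N) (T : U.ThetaModel)
    (hT : thetaClasses (MonoidHom.id X.G₁) (X.D A.Γ₀) (X.Θ k A.Γ₀) ⊆ T.Theta V c k A.Γ₀) :
    (X.P k).ClassSupplyDataAt T V c k N :=
  A.S.classSupplyDataSatAt A.sat A.strict T V c k N (X.P k).weightFunctions A.Γ₀ (X.D A.Γ₀) hT A.fam
    (fun _ hχ => SupplyResidual.WeilPairData.charInv_mem_weightFunctions hχ) A.hol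

variable (X k) in
/-- The level-indexed supply pack of type index `k` from one supply situation per `N > 0`. -/
def classSupplyPackNOf (T : U.ThetaModel)
    (hT : ∀ Γ : Level V, thetaClasses (MonoidHom.id X.G₁) (X.D Γ) (X.Θ k Γ) ⊆ T.Theta V c k Γ)
    (A : ∀ N : ℕ, 0 < N → SupplySituationAt X k N) : ClassSupplyPackN T V c k where
  K := X.K
  L := X.L
  instK := X.instK
  instKnf := X.instKnf
  instL := X.instL
  instLnf := X.instLnf
  instAlg := X.instAlg
  instFD := X.instFD
  J := X.J
  instJ := X.instJ
  GU := X.GU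
  instGU := X.instGU
  instGUtop := X.instGUtop
  instGUtg := X.instGUtg
  instGUlc := X.instGUlc
  P := X.P k
  instCompact := X.instCompact k
  cls := fun N hN => (A N hN).classSupplyDataAt T (hT _)

end Supply

section Producer

variable {U : Universe}
  (X : ∀ {Lc : CMField} {ι₁ : Lc →+* ℂ} (V : HermSpace3 Lc ι₁) (c : SeesawCtx Lc), ThetaSpaceInput U V c)

/-- **The `classPacks` PRODUCER (generic theta model).**  For any theta model `T` whose `Θ_k(Γ)` contains the
classical theta classes of `X`, E's binder `classPacks` (in the `ClassSupplyPackN` shape) follows from one supply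
situation per good sextic context, type index `k ∈ {0, 1}` and `N > 0`. -/
theorem classPacksOf (T : U.ThetaModel)
    (hT : ∀ {Lc : CMField} {ι₁ : Lc →+* ℂ} (V : HermSpace3 Lc ι₁) (c : SeesawCtx Lc) (k : Fin 4) (Γ : Level V),
      thetaClasses (MonoidHom.id (X V c).G₁) ((X V c).D Γ) ((X V c).Θ k Γ) ⊆ T.Theta V c k Γ)
    (A : ∀ {Lc : CMField} {ι₁ : Lc →+* ℂ} (V : HermSpace3 Lc ι₁) (c : SeesawCtx Lc), T.GoodCtx ι₁ c →
      Module.finrank ℚ c.K = 6 → ∀ k : Fin 4, k = 0 ∨ k = 1 → ∀ N : ℕ, 0 < N → SupplySituationAt (X V c) k N)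
    {Lc : CMField} {ι₁ : Lc →+* ℂ} (V : HermSpace3 Lc ι₁) (c : SeesawCtx Lc) (hc : T.GoodCtx ι₁ c)
    (h6 : Module.finrank ℚ c.K = 6) :
    Nonempty (ClassSupplyPackN T V c 0) ∧ Nonempty (ClassSupplyPackN T V c 1) :=
  ⟨⟨classSupplyPackNOf (X V c) 0 T (hT V c 0) (A V c hc h6 0 (Or.inl rfl))⟩,
    ⟨classSupplyPackNOf (X V c) 1 T (hT V c 1) (A V c hc h6 1 (Or.inr rfl))⟩⟩

/-- … and through `open_supply_of_classSupplyPackN`, PerL's `(Open_supply)` for such a model. -/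
theorem open_supply_of_supplySituations (T : U.ThetaModel)
    (hT : ∀ {Lc : CMField} {ι₁ : Lc →+* ℂ} (V : HermSpace3 Lc ι₁) (c : SeesawCtx Lc) (k : Fin 4) (Γ : Level V),
      thetaClasses (MonoidHom.id (X V c).G₁) ((X V c).D Γ) ((X V c).Θ k Γ) ⊆ T.Theta V c k Γ)
    (A : ∀ {Lc : CMField} {ι₁ : Lc →+* ℂ} (V : HermSpace3 Lc ι₁) (c : SeesawCtx Lc), T.GoodCtx ι₁ c →
      Module.finrank ℚ c.K = 6 → ∀ k : Fin 4, k = 0 ∨ k = 1 → ∀ N : ℕ, 0 < N → SupplySituationAt (X V c) k N)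
    (h6 : ∀ {Lc : CMField} {ι₁ : Lc →+* ℂ} (c : SeesawCtx Lc), T.GoodCtx ι₁ c → Module.finrank ℚ c.K = 6) :
    T.Open_supply :=
  open_supply_of_classSupplyPackN T fun V c hc => classPacksOf X T hT A V c hc (h6 c hc)

end Producer

/-! ### § 4. The producer at the END STATE's theta model (`hT` is `rfl`) -/

section EndState

variable (hHD : exists_isReal_hodgeModel) (hI : hodgePQ_independent_of_hodgeModel)
  (h₁ : BallQuotientUniformised)  (h₃ : CMAbelianVarietyRealised)

/-- **The `classPacks` PRODUCER at the END STATE's model** `thetaModelOf … (thetaOf _ (thetaClassInputOf _ X)) d12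
d34` (any `h emb cover wm d12 d34`): E's binder `classPacks`, in the `ClassSupplyPackN` shape, from one supply
situation per good sextic context, `k ∈ {0,1}`, `N > 0`.  The containment `hT` of `classPacksOf` is definitional. -/
theorem classPacksOf_thetaModelOf (h : Bool)
    (emb : ∀ {L : CMField} {ι₁ : L →+* ℂ} {V : HermSpace3 L ι₁} (Γ : Level V),
      (picardCMUniverse hHD hI h₁ h₃).CohC ((picardCMUniverse hHD hI h₁ h₃).pms L ι₁ V Γ) 2 →ₗ[ℂ]
        (V.latticeModel printFact_unitaryCompact_holds).toQuotientModel.H)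
    (cover : ∀ {L : CMField} {ι₁ : L →+* ℂ} {V : HermSpace3 L ι₁} (Γ Γ' : Level V),
      Γ'.Γ ≤ Γ.Γ → (picardCMUniverse hHD hI h₁ h₃).Mor ((picardCMUniverse hHD hI h₁ h₃).pms L ι₁ V Γ')
        ((picardCMUniverse hHD hI h₁ h₃).pms L ι₁ V Γ))
    (wm : ∀ {L : CMField} {ι₁ : L →+* ℂ} (V : HermSpace3 L ι₁) (c : SeesawCtx L),
      WeilThetaModel (V.latticeModel printFact_unitaryCompact_holds).toQuotientModel.G
        (V.latticeModel printFact_unitaryCompact_holds).toQuotientModel.Γ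
        (c.D.latticeModelW printFact_unitaryCompact_holds).toQuotientModel.G
        (c.D.latticeModelW printFact_unitaryCompact_holds).toQuotientModel.Γ)
    (X : ∀ {L : CMField} {ι₁ : L →+* ℂ} (V : HermSpace3 L ι₁) (c : SeesawCtx L),
      ThetaSpaceInput (picardCMUniverse hHD hI h₁ h₃) V c)
    (d12 d34 : ∀ {L : CMField}, SeesawCtx L → HodgeCM.Universe.SideData L)
    (A : ∀ {L : CMField} {ι₁ : L →+* ℂ} (V : HermSpace3 L ι₁) (c : SeesawCtx L),
      (thetaModelOf hHD hI h₁ h₃ h emb cover wm (thetaOf _ (thetaClassInputOf _ X)) d12 d34).GoodCtx ι₁ c →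
      Module.finrank ℚ c.K = 6 → ∀ k : Fin 4, k = 0 ∨ k = 1 → ∀ N : ℕ, 0 < N → SupplySituationAt (X V c) k N)
    {L : CMField} {ι₁ : L →+* ℂ} (V : HermSpace3 L ι₁) (c : SeesawCtx L)
    (hc : (thetaModelOf hHD hI h₁ h₃ h emb cover wm (thetaOf _ (thetaClassInputOf _ X)) d12 d34).GoodCtx ι₁ c)
    (h6 : Module.finrank ℚ c.K = 6) :
    Nonempty (ClassSupplyPackN
        (thetaModelOf hHD hI h₁ h₃ h emb cover wm (thetaOf _ (thetaClassInputOf _ X)) d12 d34) V c 0) ∧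
      Nonempty (ClassSupplyPackN
        (thetaModelOf hHD hI h₁ h₃ h emb cover wm (thetaOf _ (thetaClassInputOf _ X)) d12 d34) V c 1) :=
  classPacksOf X _ (fun _ _ _ _ _ hx => hx) A V c hc h6

end EndState

end Model
end HodgeCM

end
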